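import Mathlib
import HarnessLib
import Summits.HubbardSuperconductivity.HubbardSuperconductivity.Theorems.KLProgrammeKLRegimeSplitTwoLegMomentsFromPosition

/-!
# Route `KLProgramme` — K3 engine-flow child 20437 (`KLRegimeEngineV17F2`), stub (C) door (B): the FOURIER BRIDGE for a LEG PAIR of a kernel of ANY
# degree — position moments of `𝔉⁻¹[k⃗ ↦ F_{m+2}((n,k⃗)σ⁺, (n,k⃗)σ⁻, X₁, …, X_m)]` from the pinned, spatially weighted `L¹` norm of the
# trivial-multiplier position kernel

Cell `gate-hubbard-kl`, seat p2 (g12).  Door (B) of stub (C) (`…EngineFrameShiftMomentDoorFlow.moment_selfEnergy_flowStep_sub_le`, p545976;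
`…EngineFrameShiftReadingDoorFlow`, p547378) is stated against the MOMENTS `Σ_y (1+|ỹ₀|+|ỹ₁|)ʳ ‖𝔉⁻¹[k⃗ ↦ data(k⃗)](y)‖` of two momentum-space
data of the interpolated one-shot action: the two-leg kernel `k⃗ ↦ F₂(((n,k⃗),σ,+),((n,k⃗),σ,−))` (constant `S`) and the four-leg kernel
`k⃗ ↦ F₄(((n,k⃗),σ,+),((n,k⃗),σ,−), Ā, A)` (constant `N`, uniformly in the fixed legs `Ā = (A.1, 1 − A.2)`, `A`).  The fermionic expansion
(the (b)-F tower; the class-#7 atom `TwoLegMomentsAt`, KL STATUS 2026-08-27 16:32:40Z «DUAL CONFIRMED») exports pinned, weighted `L¹` norms of the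
POSITION-SPACE kernels `W_m = sectorisedKernel β (trivialMultiplier) G m Ω` (BGM (2.17)).  This file is the bridge between the two currencies, for
ANY `G : HubbardGrassmann L M`, any degree `m + 2`, any fixed legs `X₁ … X_m` behind the pair, and any non-negative spatial weight `w`:

* `card_pow_mul_torusFourierInv_kernel_legPair_eq` — the inversion identity
  `|Λ|^{m+2} · 𝔉⁻¹[k⃗ ↦ F_{m+2}((n,k⃗)σ⁺,(n,k⃗)σ⁻,X)](y) = Σ_{x : x⃗₁ − x⃗₀ = y} W_{m+2,Ω}(x) · e^{iω_n(t₀ − t₁)} · conj ∏_{j} e^{-is_{c_j}X_j·x_{j+2}}`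
  (`sum_sectorisedKernel_mul_conj_prod` + `Σ_{k⃗} χ_{k⃗}(x⃗₀ − x⃗₁) χ_{k⃗}(y) = L²·[x⃗₁ − x⃗₀ = y]`);
* `card_pow_mul_norm_torusFourierInv_kernel_legPair_le` — `|Λ|^{m+2} ‖𝔉⁻¹[…](y)‖ ≤ Σ_{x : x⃗₁ − x⃗₀ = y} ‖W_{m+2,Ω}(x)‖`;
* **`sum_weight_mul_norm_torusFourierInv_kernel_legPair_le`** — if `ε_x^{m+1} Σ_{x : x 0 = x₀} w(x⃗₁ − x⃗₀) ‖W_{m+2,Ω}(x)‖ ≤ M_w` for every pinned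
  `x₀`, then `Σ_y w(y) ‖𝔉⁻¹[k⃗ ↦ F_{m+2}(…)](y)‖ ≤ M_w / (βL²)^{m+1}` (`ε_x |Λ| = βL²`; the average over `x₀` is below the sup);
* the two instances in door (B)'s literal shapes: **`sum_weight_mul_norm_torusFourierInv_kernel_two_le`** (`m = 0`, string `![(K,σ,+),(K,σ,−)]`,
  bound `M_w/(βL²)` — the `S` input) and **`sum_weight_mul_norm_torusFourierInv_kernel_four_le`** (`m = 2`, string
  `Fin.snoc (Fin.snoc ![(K,σ,+),(K,σ,−)] (A.1, 1 − A.2)) A`, bound `M_w/(βL²)³` — the `N` input; the position norm does not see the momentum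
  `A.1.1` of the fixed legs, only their spin `A.1.2` and charge `A.2`).

Companion of p1b's `…TwoLegMomentsFromPosition` (the `torusCosCoeff ∘ Re` currency of the two-leg slot, degree `2` only); same mechanism, the
`torusFourierInv` currency and every degree.  Proofs only; no definitions; nothing about the model is asserted; nothing asserts superconductivity.
References: BGM 2006 §2.1 (2.4)–(2.5), §2.3 (2.17), §2.7 (2.70) [cite: BenfattoGiulianiMastropietro2006]; Salmhofer 1999 App. B.5.5.
-/

noncomputable section

namespace Summit.HubbardSuperconductivity.HubbardSuperconductivity.Theorems.TwoLegFourier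

set_option linter.dupNamespace false -- summit = problem name (single-conjunct summit), D-0017

open Finset Complex
open Literature.MathematicalPhysics.QuantumLattice Literature.Probability.LatticeModels GrassmannAlgebra

variable {L M : ℕ} [NeZero L]

/-! ## §1 The inversion identity for a leg pair in front of `m` fixed legs -/

omit [NeZero L] in
/-- The label string `((k⃗ᵢ, τᵢ), cᵢ)ᵢ` assembled from the momenta `(K, K, X₁.1.1, …)` and the discrete labels
`((0,σ),+), ((0,σ),−), ((0,τ_j),c_j)` IS the string `(K,σ,+), (K,σ,−), X₁, …, X_m`. -/
theorem legPair_string_eq {m : ℕ} (K : FreqMomentum L M) (σ : Fin 2) (rest : Fin m → HubbardFieldIdx L M) :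
    (fun i : Fin (m + 2) =>
      ((((Fin.cons K (Fin.cons K fun j => (rest j).1.1) : Fin (m + 2) → FreqMomentum L M) i,
        ((Fin.cons ((0, σ), 0) (Fin.cons ((0, σ), 1) fun j => (((0 : Fin 1), (rest j).1.2), (rest j).2)) :
          Fin (m + 2) → SectorLeg 1) i).1.2),
        ((Fin.cons ((0, σ), 0) (Fin.cons ((0, σ), 1) fun j => (((0 : Fin 1), (rest j).1.2), (rest j).2)) :
          Fin (m + 2) → SectorLeg 1) i).2) : HubbardFieldIdx L M)) =
      Fin.cons ((K, σ), 0) (Fin.cons ((K, σ), 1) rest) := by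
  funext i
  refine Fin.cases ?_ (fun i' => ?_) i
  · simp only [Fin.cons_zero]
  · refine Fin.cases ?_ (fun j => ?_) i'
    · simp only [Fin.cons_succ, Fin.cons_zero]
    · simp only [Fin.cons_succ]

/-- **Fourier inversion for a leg pair**: with `W = sectorisedKernel β 1 G (m+2) ((σ,+),(σ,−),(τ_j,c_j)_j)` the trivial-multiplier position
kernel of the string, for every `y`,
`|Λ|^{m+2} · 𝔉⁻¹[k⃗ ↦ F_{m+2}(((n,k⃗),σ,+),((n,k⃗),σ,−),X)](y) = Σ_{x : x⃗₀ − x⃗₁ + y = 0} W(x) · e^{iω_n(t₀ − t₁)} · conj(∏_j e^{-is_{c_j} X_j·x_{j+2}})`. -/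
theorem card_pow_mul_torusFourierInv_kernel_legPair_eq {β : ℝ} (hβ : β ≠ 0) (G : HubbardGrassmann L M) {m : ℕ} (n : MatsubaraIdx M)
    (σ : Fin 2) (rest : Fin m → HubbardFieldIdx L M) (y : TorusSite 2 L) :
    (Fintype.card (SpaceTimeIdx L M) : ℂ) ^ (m + 2) *
        torusFourierInv (fun kv : TorusSite 2 L =>
          kernel ℂ G (m + 2) (Fin.cons ((((n, kv), σ), 0) : HubbardFieldIdx L M) (Fin.cons (((n, kv), σ), 1) rest))) y =
      ∑ x : Fin (m + 2) → SpaceTimeIdx L M, if (x 0).2 - (x 1).2 + y = 0 then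
        sectorisedKernel L M β (trivialMultiplier L M) G (m + 2)
            (Fin.cons ((0, σ), 0) (Fin.cons ((0, σ), 1) fun j => (((0 : Fin 1), (rest j).1.2), (rest j).2))) x *
          (Complex.exp (((matsubaraFreq β M n * (imagTime β M (x 0).1 - imagTime β M (x 1).1) : ℝ) : ℂ) * I) *
            (starRingEnd ℂ) (∏ j : Fin m, hubbardPlaneWave L M β (rest j).2 (rest j).1.1 (x j.succ.succ)))
      else 0 := by
  classical
  set Ω : Fin (m + 2) → SectorLeg 1 :=
    Fin.cons ((0, σ), 0) (Fin.cons ((0, σ), 1) fun j => (((0 : Fin 1), (rest j).1.2), (rest j).2)) with hΩ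
  set W := sectorisedKernel L M β (trivialMultiplier L M) G (m + 2) Ω with hW
  have hL : ((L : ℂ) ^ 2) ≠ 0 := pow_ne_zero _ (by exact_mod_cast NeZero.ne L)
  -- inversion at each spatial momentum of the pair
  have hinv : ∀ kv : TorusSite 2 L, (Fintype.card (SpaceTimeIdx L M) : ℂ) ^ (m + 2) *
      kernel ℂ G (m + 2) (Fin.cons ((((n, kv), σ), 0) : HubbardFieldIdx L M) (Fin.cons (((n, kv), σ), 1) rest)) =
      ∑ x : Fin (m + 2) → SpaceTimeIdx L M, W x *
        (Complex.exp (((matsubaraFreq β M n * (imagTime β M (x 0).1 - imagTime β M (x 1).1) : ℝ) : ℂ) * I) *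
          (starRingEnd ℂ) (∏ j : Fin m, hubbardPlaneWave L M β (rest j).2 (rest j).1.1 (x j.succ.succ))) *
        torusChar kv ((x 0).2 - (x 1).2) := by
    intro kv
    have h := sum_sectorisedKernel_mul_conj_prod hβ (trivialMultiplier L M) G (m + 2) Ω
      (Fin.cons (n, kv) (Fin.cons (n, kv) fun j => (rest j).1.1))
    rw [hΩ, legPair_string_eq (n, kv) σ rest, ← hΩ] at h
    have hF : (∏ i : Fin (m + 2), trivialMultiplier L M (Ω i).1.1
        ((Fin.cons (n, kv) (Fin.cons (n, kv) fun j => (rest j).1.1) : Fin (m + 2) → FreqMomentum L M) i)) = 1 :=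
      prod_eq_one fun _ _ => rfl
    rw [hF, mul_one] at h
    rw [← h]
    refine sum_congr rfl fun x _ => ?_
    rw [Fin.prod_univ_succ, Fin.prod_univ_succ, ← mul_assoc, map_mul]
    simp only [hΩ, Fin.cons_zero, Fin.cons_succ, Fin.cons_one, Fin.succ_zero_eq_one]
    rw [conj_phase_eq_cexp_mul_torusChar β (n, kv) (x 0) (x 1)]
    ring
  -- assemble the inverse transform
  rw [torusFourierInv_eq_sum_torusChar, mul_left_comm, mul_sum]
  have hstep : ∀ kv : TorusSite 2 L, (Fintype.card (SpaceTimeIdx L M) : ℂ) ^ (m + 2) *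
      (kernel ℂ G (m + 2) (Fin.cons ((((n, kv), σ), 0) : HubbardFieldIdx L M) (Fin.cons (((n, kv), σ), 1) rest)) * torusChar kv y) =
      ∑ x : Fin (m + 2) → SpaceTimeIdx L M, W x *
        (Complex.exp (((matsubaraFreq β M n * (imagTime β M (x 0).1 - imagTime β M (x 1).1) : ℝ) : ℂ) * I) *
          (starRingEnd ℂ) (∏ j : Fin m, hubbardPlaneWave L M β (rest j).2 (rest j).1.1 (x j.succ.succ))) *
        torusChar kv ((x 0).2 - (x 1).2 + y) := by
    intro kv
    rw [← mul_assoc, hinv kv, sum_mul]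
    refine sum_congr rfl fun x _ => ?_
    rw [torusChar_add_right]
    ring
  simp_rw [hstep]
  rw [sum_comm, mul_sum]
  refine sum_congr rfl fun x _ => ?_
  rw [← mul_sum, sum_torusChar_left]
  split_ifs with h
  · rw [mul_comm, mul_assoc, mul_inv_cancel₀ hL, mul_one]
  · rw [mul_zero, mul_zero]

/-- **The norm form**: `|Λ|^{m+2} ‖𝔉⁻¹[k⃗ ↦ F_{m+2}((n,k⃗)σ⁺,(n,k⃗)σ⁻,X)](y)‖ ≤ Σ_{x : x⃗₁ − x⃗₀ = y} ‖W_{m+2,Ω}(x)‖` (plane waves are unimodular). -/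
theorem card_pow_mul_norm_torusFourierInv_kernel_legPair_le {β : ℝ} (hβ : β ≠ 0) (G : HubbardGrassmann L M) {m : ℕ}
    (n : MatsubaraIdx M) (σ : Fin 2) (rest : Fin m → HubbardFieldIdx L M) (y : TorusSite 2 L) :
    (Fintype.card (SpaceTimeIdx L M) : ℝ) ^ (m + 2) *
        ‖torusFourierInv (fun kv : TorusSite 2 L =>
          kernel ℂ G (m + 2) (Fin.cons ((((n, kv), σ), 0) : HubbardFieldIdx L M) (Fin.cons (((n, kv), σ), 1) rest))) y‖ ≤
      ∑ x : Fin (m + 2) → SpaceTimeIdx L M, if y = (x 1).2 - (x 0).2 then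
        ‖sectorisedKernel L M β (trivialMultiplier L M) G (m + 2)
            (Fin.cons ((0, σ), 0) (Fin.cons ((0, σ), 1) fun j => (((0 : Fin 1), (rest j).1.2), (rest j).2))) x‖
      else 0 := by
  have h := congrArg (fun z : ℂ => ‖z‖) (card_pow_mul_torusFourierInv_kernel_legPair_eq hβ G n σ rest y)
  simp only [norm_mul, norm_pow, Complex.norm_natCast] at h
  rw [h]
  refine (norm_sum_le _ _).trans (sum_le_sum fun x _ => ?_)
  have hiff : (x 0).2 - (x 1).2 + y = 0 ↔ y = (x 1).2 - (x 0).2 := by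
    rw [add_eq_zero_iff_neg_eq, neg_sub, eq_comm]
  by_cases hy : y = (x 1).2 - (x 0).2
  · rw [if_pos (hiff.2 hy), if_pos hy, norm_mul, norm_mul, Complex.norm_exp_ofReal_mul_I, one_mul, RCLike.norm_conj, norm_prod,
      prod_eq_one (fun j _ => norm_hubbardPlaneWave L M β _ _ _), mul_one]
  · rw [if_neg (fun h' => hy (hiff.1 h')), if_neg hy, norm_zero]

/-! ## §2 The weighted position moments -/

/-- **MOMENTS OF `𝔉⁻¹` OF A LEG-PAIR DATUM FROM THE PINNED WEIGHTED POSITION NORM.**  For `β > 0`, any `G`, any degree `m + 2`, a frequency `n`,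
a spin `σ`, fixed legs `X : Fin m → HubbardFieldIdx` behind the pair, and any non-negative spatial weight `w` read on the torus difference
`x⃗₁ − x⃗₀` of the pair: if `ε_x^{m+1} Σ_{x : x 0 = x₀} w(x⃗₁ − x⃗₀) ‖W_{m+2,Ω}(x)‖ ≤ M_w` for every `x₀` (`W` the trivial-multiplier position kernel
of the string, `Ω = ((σ,+),(σ,−),(τ_j,c_j)_j)`), then `Σ_y w(y) ‖𝔉⁻¹[k⃗ ↦ F_{m+2}(((n,k⃗),σ,+),((n,k⃗),σ,−),X)](y)‖ ≤ M_w / (βL²)^{m+1}`.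
[cite: BenfattoGiulianiMastropietro2006, §2.3 (2.17)] -/
theorem sum_weight_mul_norm_torusFourierInv_kernel_legPair_le [NeZero M] {β : ℝ} (hβ : 0 < β) (G : HubbardGrassmann L M) {m : ℕ}
    (n : MatsubaraIdx M) (σ : Fin 2) (rest : Fin m → HubbardFieldIdx L M) {w : TorusSite 2 L → ℝ} (hw : ∀ z, 0 ≤ w z) {Mw : ℝ}
    (hM : ∀ x₀ : SpaceTimeIdx L M, imagTimeWeight β M ^ (m + 1) *
      ∑ x ∈ (univ : Finset (Fin (m + 2) → SpaceTimeIdx L M)).filter (fun x => x 0 = x₀),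
        w ((x 1).2 - (x 0).2) * ‖sectorisedKernel L M β (trivialMultiplier L M) G (m + 2)
            (Fin.cons ((0, σ), 0) (Fin.cons ((0, σ), 1) fun j => (((0 : Fin 1), (rest j).1.2), (rest j).2))) x‖ ≤ Mw) :
    ∑ y : TorusSite 2 L, w y * ‖torusFourierInv (fun kv : TorusSite 2 L =>
        kernel ℂ G (m + 2) (Fin.cons ((((n, kv), σ), 0) : HubbardFieldIdx L M) (Fin.cons (((n, kv), σ), 1) rest))) y‖ ≤
      Mw / (β * (L : ℝ) ^ 2) ^ (m + 1) := by
  set W := sectorisedKernel L M β (trivialMultiplier L M) G (m + 2)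
    (Fin.cons ((0, σ), 0) (Fin.cons ((0, σ), 1) fun j => (((0 : Fin 1), (rest j).1.2), (rest j).2))) with hW
  set F : TorusSite 2 L → ℂ := fun kv : TorusSite 2 L =>
    kernel ℂ G (m + 2) (Fin.cons ((((n, kv), σ), 0) : HubbardFieldIdx L M) (Fin.cons (((n, kv), σ), 1) rest)) with hF
  set d : (Fin (m + 2) → SpaceTimeIdx L M) → TorusSite 2 L := fun x => (x 1).2 - (x 0).2 with hd
  set P : ℝ := (Fintype.card (SpaceTimeIdx L M) : ℝ) with hP
  have hPpos : 0 < P := by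
    rw [hP]; exact_mod_cast (Fintype.card_pos_iff.2 ⟨(n, 0)⟩ : 0 < Fintype.card (SpaceTimeIdx L M))
  have hεpos : 0 < imagTimeWeight β M := by
    unfold imagTimeWeight
    have : (0 : ℝ) < M := by
      have hM : 0 < 2 * M := n.pos
      exact_mod_cast Nat.pos_of_mul_pos_left hM
    positivity
  have hεP : imagTimeWeight β M * P = β * (L : ℝ) ^ 2 := imagTimeWeight_mul_card β L M
  -- the total weighted mass, sliced by the pinned leg
  have htot : ∑ x : Fin (m + 2) → SpaceTimeIdx L M, w (d x) * ‖W x‖ ≤ P * (Mw / imagTimeWeight β M ^ (m + 1)) := by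
    rw [← sum_fiberwise_of_maps_to (s := univ) (t := (univ : Finset (SpaceTimeIdx L M))) (g := fun x => x 0)
      (fun _ _ => mem_univ _)]
    have hPsum : P * (Mw / imagTimeWeight β M ^ (m + 1)) = ∑ _x₀ : SpaceTimeIdx L M, Mw / imagTimeWeight β M ^ (m + 1) := by
      rw [sum_const, card_univ, nsmul_eq_mul, hP]
    rw [hPsum]
    refine sum_le_sum fun x₀ _ => ?_
    rw [le_div_iff₀ (pow_pos hεpos _), mul_comm]
    exact hM x₀
  -- the collapsed sum
  have hcol : ∑ y : TorusSite 2 L, w y * (∑ x : Fin (m + 2) → SpaceTimeIdx L M, if y = d x then ‖W x‖ else 0) =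
      ∑ x : Fin (m + 2) → SpaceTimeIdx L M, w (d x) * ‖W x‖ := by
    simp_rw [mul_sum, mul_ite, mul_zero]
    rw [sum_comm]
    refine sum_congr rfl fun x _ => ?_
    rw [sum_ite_eq' univ (d x) (fun y => w y * ‖W x‖), if_pos (mem_univ _)]
  -- pointwise bound, summed
  have hpt : ∀ y, w y * ‖torusFourierInv F y‖ ≤
      w y * ((∑ x : Fin (m + 2) → SpaceTimeIdx L M, if y = d x then ‖W x‖ else 0) / P ^ (m + 2)) := fun y =>
    mul_le_mul_of_nonneg_left ((le_div_iff₀ (pow_pos hPpos _)).2 (by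
      rw [mul_comm]; exact card_pow_mul_norm_torusFourierInv_kernel_legPair_le hβ.ne' G n σ rest y)) (hw y)
  calc ∑ y, w y * ‖torusFourierInv F y‖
      ≤ ∑ y, w y * ((∑ x : Fin (m + 2) → SpaceTimeIdx L M, if y = d x then ‖W x‖ else 0) / P ^ (m + 2)) :=
        sum_le_sum fun y _ => hpt y
    _ = (∑ y : TorusSite 2 L, w y * (∑ x : Fin (m + 2) → SpaceTimeIdx L M, if y = d x then ‖W x‖ else 0)) / P ^ (m + 2) := by
        rw [sum_div]
        exact sum_congr rfl fun y _ => by ring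
    _ = (∑ x : Fin (m + 2) → SpaceTimeIdx L M, w (d x) * ‖W x‖) / P ^ (m + 2) := by rw [hcol]
    _ ≤ P * (Mw / imagTimeWeight β M ^ (m + 1)) / P ^ (m + 2) := by gcongr
    _ = Mw / (imagTimeWeight β M * P) ^ (m + 1) := by
        field_simp
        ring
    _ = Mw / (β * (L : ℝ) ^ 2) ^ (m + 1) := by rw [hεP]

/-! ## §3 The two instances in door (B)'s shapes -/

/-- **THE `S` INPUT OF DOOR (B) FROM POSITION SPACE** (degree `2`): if `ε_x Σ_{x : x 0 = x₀} w(x⃗₁ − x⃗₀) ‖W₂((σ,+),(σ,−))(x)‖ ≤ M_w` for every `x₀`,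
then `Σ_y w(y) ‖𝔉⁻¹[k⃗ ↦ F₂(((n,k⃗),σ,+),((n,k⃗),σ,−))](y)‖ ≤ M_w / (βL²)`. -/
theorem sum_weight_mul_norm_torusFourierInv_kernel_two_le [NeZero M] {β : ℝ} (hβ : 0 < β) (G : HubbardGrassmann L M)
    (n : MatsubaraIdx M) (σ : Fin 2) {w : TorusSite 2 L → ℝ} (hw : ∀ z, 0 ≤ w z) {Mw : ℝ}
    (hM : ∀ x₀ : SpaceTimeIdx L M, imagTimeWeight β M *
      ∑ x ∈ (univ : Finset (Fin 2 → SpaceTimeIdx L M)).filter (fun x => x 0 = x₀),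
        w ((x 1).2 - (x 0).2) *
          ‖sectorisedKernel L M β (trivialMultiplier L M) G 2 (![((0, σ), 0), ((0, σ), 1)] : Fin 2 → SectorLeg 1) x‖ ≤ Mw) :
    ∑ y : TorusSite 2 L, w y * ‖torusFourierInv (fun kv : TorusSite 2 L =>
        kernel ℂ G 2 ![((((n, kv), σ), 0) : HubbardFieldIdx L M), (((n, kv), σ), 1)]) y‖ ≤ Mw / (β * (L : ℝ) ^ 2) := by
  have hΩ : (Fin.cons ((0, σ), 0) (Fin.cons ((0, σ), 1) fun j : Fin 0 =>
      ((((0 : Fin 1), ((![] : Fin 0 → HubbardFieldIdx L M) j).1.2), ((![] : Fin 0 → HubbardFieldIdx L M) j).2) : SectorLeg 1)) :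
        Fin 2 → SectorLeg 1) = ![((0, σ), 0), ((0, σ), 1)] := by
    funext i; fin_cases i <;> rfl
  have hlegs : ∀ kv : TorusSite 2 L, (Fin.cons ((((n, kv), σ), 0) : HubbardFieldIdx L M)
      (Fin.cons (((n, kv), σ), 1) (![] : Fin 0 → HubbardFieldIdx L M)) : Fin 2 → HubbardFieldIdx L M) =
        ![((((n, kv), σ), 0) : HubbardFieldIdx L M), (((n, kv), σ), 1)] := fun kv => by
    funext i; fin_cases i <;> rfl
  have h := sum_weight_mul_norm_torusFourierInv_kernel_legPair_le hβ G n σ (![] : Fin 0 → HubbardFieldIdx L M) hw (Mw := Mw)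
    (fun x₀ => by simpa only [hΩ, zero_add, pow_one] using hM x₀)
  simpa only [hlegs, zero_add, pow_one] using h

/-- **THE `N` INPUT OF DOOR (B) FROM POSITION SPACE** (degree `4`): for fixed legs `Ā = (A.1, 1 − A.2)`, `A`, if
`ε_x³ Σ_{x : x 0 = x₀} w(x⃗₁ − x⃗₀) ‖W₄((σ,+),(σ,−),(A.1.2, 1 − A.2),(A.1.2, A.2))(x)‖ ≤ M_w` for every `x₀`, then
`Σ_y w(y) ‖𝔉⁻¹[k⃗ ↦ F₄(((n,k⃗),σ,+),((n,k⃗),σ,−),Ā,A)](y)‖ ≤ M_w / (βL²)³` — the position norm does not see the momentum `A.1.1`. -/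
theorem sum_weight_mul_norm_torusFourierInv_kernel_four_le [NeZero M] {β : ℝ} (hβ : 0 < β) (G : HubbardGrassmann L M)
    (n : MatsubaraIdx M) (σ : Fin 2) (A : HubbardFieldIdx L M) {w : TorusSite 2 L → ℝ} (hw : ∀ z, 0 ≤ w z) {Mw : ℝ}
    (hM : ∀ x₀ : SpaceTimeIdx L M, imagTimeWeight β M ^ 3 *
      ∑ x ∈ (univ : Finset (Fin 4 → SpaceTimeIdx L M)).filter (fun x => x 0 = x₀),
        w ((x 1).2 - (x 0).2) *
          ‖sectorisedKernel L M β (trivialMultiplier L M) G 4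
            (![((0, σ), 0), ((0, σ), 1), ((0, A.1.2), 1 - A.2), ((0, A.1.2), A.2)] : Fin 4 → SectorLeg 1) x‖ ≤ Mw) :
    ∑ y : TorusSite 2 L, w y * ‖torusFourierInv (fun kv : TorusSite 2 L =>
        kernel ℂ G 4 (Fin.snoc (Fin.snoc ![((((n, kv), σ), 0) : HubbardFieldIdx L M), (((n, kv), σ), 1)] (A.1, 1 - A.2) :
          Fin 3 → HubbardFieldIdx L M) A)) y‖ ≤ Mw / (β * (L : ℝ) ^ 2) ^ 3 := by
  have hΩ : (Fin.cons ((0, σ), 0) (Fin.cons ((0, σ), 1) fun j : Fin 2 =>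
      ((((0 : Fin 1), ((![(A.1, 1 - A.2), A] : Fin 2 → HubbardFieldIdx L M) j).1.2),
        ((![(A.1, 1 - A.2), A] : Fin 2 → HubbardFieldIdx L M) j).2) : SectorLeg 1)) : Fin 4 → SectorLeg 1) =
        ![((0, σ), 0), ((0, σ), 1), ((0, A.1.2), 1 - A.2), ((0, A.1.2), A.2)] := by
    funext i; fin_cases i <;> rfl
  have hlegs : ∀ kv : TorusSite 2 L, (Fin.cons ((((n, kv), σ), 0) : HubbardFieldIdx L M)
      (Fin.cons (((n, kv), σ), 1) (![(A.1, 1 - A.2), A] : Fin 2 → HubbardFieldIdx L M)) : Fin 4 → HubbardFieldIdx L M) =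
        (Fin.snoc (Fin.snoc ![((((n, kv), σ), 0) : HubbardFieldIdx L M), (((n, kv), σ), 1)] (A.1, 1 - A.2) :
          Fin 3 → HubbardFieldIdx L M) A) := fun kv => by
    funext i; fin_cases i <;> rfl
  have h := sum_weight_mul_norm_torusFourierInv_kernel_legPair_le hβ G n σ (![(A.1, 1 - A.2), A] : Fin 2 → HubbardFieldIdx L M) hw
    (Mw := Mw) (fun x₀ => by simpa only [hΩ] using hM x₀)
  simpa only [hlegs] using h

end Summit.HubbardSuperconductivity.HubbardSuperconductivity.Theorems.TwoLegFourier

end
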